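import Literature.MathematicalPhysics.QuantumLattice.WilsonQuarkMatrixPositivity
import Literature.MathematicalPhysics.QuantumFieldTheory.StochasticDeterminantNonNormal
import HarnessLib

/-!
# The bosonic Gaussian representation `1/det D_W = ∫D[η] e^{−η†D_Wη}` of the inverse Wilson fermion
# determinant, for every gauge field at `|K| < 1/8`

Topic `MathematicalPhysics/QuantumLattice`; a LEAF joining two tree results:

* `WilsonQuarkMatrixPositivity.lean` — Montvay–Münster §7.4 "the matrix `Q` can be proven to be
  positive": for Wilson parameter `r = 1`, a unitary colour representation `ρ`, EVERY gauge field `U`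
  and every mass `m > 0` (hopping parameter `|K| = 1/(2m + 8) < 1/8`), the Wilson–Dirac operator
  `D_W(U, m)` has positive definite Hermitian part, `Re ⟨v, D_W v⟩ ≥ m⟨v, v⟩ > 0`
  (`re_star_dotProduct_wilsonDirac_mulVec_pos`);
* `StochasticDeterminantNonNormal.lean` — Finkenrath–Knechtli–Leder (2.1) (= Altland–Simons (3.17),
  Brydges–Imbrie–Slade Lemma 2.1) for NON-normal matrices: `λ(A + A†) > 0` ⟹
  `∫_{ℂⁿ} e^{−η†Aη} dη = πⁿ/det A`, absolutely convergent, and the mean `⟨W_A⟩ = 1/det A` of the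
  single-noise Gaussian estimator (2.2).

The Wilson–Dirac operator is not a normal matrix, so the Hermitian-case Gaussian integral of the tree
(`complexGaussianIntegral_posDef_holds`) does not apply to it; the general case does, at every gauge
field, with no hypothesis left but `m > 0`.  PUBLISHED RESULTS instantiated on the tree's own object
`wilsonDirac ρ U m 1` — no named fact is introduced (D-0026).  Wanted by the cell pub-lqcd (venture
`LatticeQCDFlow`, HOME/R2-SCOPE.md §3 E2 D1/D2, N2 (stochastic determinant / determinant-ratio
estimators act on the Wilson operator), §4 C-PM; FANOUT row 38).

## What is proved here (`r = 1`, unitary `ρ`, any `U : GaugeConfig 4 L G`, `m > 0`)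

* `posDef_wilsonDirac_add_conjTranspose` — `λ(D_W + D_W†) > 0` (FKL's condition (2.1) for `A = D_W`).
* `integrable_cexp_neg_quadForm_wilsonDirac` — `η ↦ e^{−η†D_Wη}` is absolutely integrable on
  `ℂ^{Λ×N×4}`.
* `integral_cexp_neg_quadForm_wilsonDirac` — `∫ e^{−η†D_Wη} dη = πⁿ/det D_W`;
  `integral_D_cexp_neg_quadForm_wilsonDirac` — `∫D[η] e^{−η†D_Wη} = 1/det D_W`.
* `integral_gaussian_mul_detInvEst_wilsonDirac` — the Gaussian-noise estimator
  `W(η) = e^{−η†(D_W − I)η}` of `1/det D_W` is unbiased: `∫e^{−|η|²}W(η)dη = πⁿ/det D_W`.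

## References
* [FinkenrathKnechtliLeder2013OneFlavor] J. Finkenrath, F. Knechtli, B. Leder, Nucl. Phys. B 877
  (2013) 441–456, §2.1 eqs. (2.1)–(2.2), §2.2, App. A.
* [MontvayMunster1994] I. Montvay, G. Münster, Quantum Fields on a Lattice, CUP 1994, §7.4 (text after
  (7.136)), §4.2.3 (4.111).
* [AltlandSimons2010] A. Altland, B. D. Simons, Condensed Matter Field Theory, CUP 2010, §3.2 (3.17).
-/

namespace Literature.MathematicalPhysics.QuantumLattice

open MeasureTheory Matrix Complex
open Literature.Probability.LatticeModels (TorusSite)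
open Literature.MathematicalPhysics.QuantumFieldTheory
open Literature.MathematicalPhysics.QuantumFieldTheory.StochasticDeterminant
open scoped BigOperators ComplexOrder ComplexConjugate Real

variable {L N : ℕ} [NeZero L] {G : Type*} [Group G] (ρ : G →* Matrix (Fin N) (Fin N) ℂ)

/-- **Finkenrath–Knechtli–Leder's condition `λ(A + A†) > 0` holds for `A = D_W(U, m)`, `m > 0`**:
the Hermitian part of the Wilson–Dirac operator (`r = 1`, unitary `ρ`) is positive definite at EVERY
gauge field — Montvay–Münster's "the matrix `Q` can be proven to be positive" (`|K| < 1/8`) read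
through the field-of-values form of the condition (`posDef_add_conjTranspose_iff_forall_re_pos`).
[cite: MontvayMunster1994, §7.4 (text after (7.136)) with §4.2.3 (4.111)];
[cite: FinkenrathKnechtliLeder2013OneFlavor, §2.1, condition of eq. (2.1) and App. A (A.9)] -/
theorem posDef_wilsonDirac_add_conjTranspose (hρ : ∀ g, ρ g ∈ Matrix.unitaryGroup (Fin N) ℂ)
    (U : GaugeConfig 4 L G) {m : ℝ} (hm : 0 < m) :
    (wilsonDirac ρ U m 1 + (wilsonDirac ρ U m 1)ᴴ).PosDef :=
  (posDef_add_conjTranspose_iff_forall_re_pos _).mpr fun _ hv =>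
    re_star_dotProduct_wilsonDirac_mulVec_pos ρ hρ U hm hv

/-- **Absolute convergence of the bosonic Gaussian integral for the Wilson operator**: for `m > 0`
and every gauge field, `η ↦ e^{−η†D_W(U,m)η}` is integrable on `ℂ^{Λ×N×4}` ("`λ(A + A†) > 0` is the
necessary and sufficient condition for the absolute convergence").
[cite: FinkenrathKnechtliLeder2013OneFlavor, §2.1, sentence after eq. (2.1)];
[cite: MontvayMunster1994, §7.4 (text after (7.136))] -/
theorem integrable_cexp_neg_quadForm_wilsonDirac (hρ : ∀ g, ρ g ∈ Matrix.unitaryGroup (Fin N) ℂ)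
    (U : GaugeConfig 4 L G) {m : ℝ} (hm : 0 < m) :
    Integrable fun η : TorusSite 4 L × Fin N × Fin 4 → ℂ =>
      cexp (-(star η ⬝ᵥ (wilsonDirac ρ U m 1 *ᵥ η))) :=
  (integrable_cexp_neg_quadForm_iff _).mpr (posDef_wilsonDirac_add_conjTranspose ρ hρ U hm)

/-- **`∫_{ℂⁿ} e^{−η†D_Wη} dη = πⁿ/det D_W(U, m)`** (`n = |Λ|·N·4`) for `m > 0`, unitary `ρ` and EVERY
gauge field `U`: Finkenrath–Knechtli–Leder (2.1) / Altland–Simons (3.17) for the (non-normal)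
Wilson–Dirac operator, whose Hermitian part is positive by Montvay–Münster §7.4.
[cite: FinkenrathKnechtliLeder2013OneFlavor, §2.1 eq. (2.1)]; [cite: AltlandSimons2010, §3.2 eq.
(3.17)]; [cite: MontvayMunster1994, §7.4 (text after (7.136))] -/
theorem integral_cexp_neg_quadForm_wilsonDirac (hρ : ∀ g, ρ g ∈ Matrix.unitaryGroup (Fin N) ℂ)
    (U : GaugeConfig 4 L G) {m : ℝ} (hm : 0 < m) :
    ∫ η : TorusSite 4 L × Fin N × Fin 4 → ℂ, cexp (-(star η ⬝ᵥ (wilsonDirac ρ U m 1 *ᵥ η))) =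
      (π : ℂ) ^ Fintype.card (TorusSite 4 L × Fin N × Fin 4) / (wilsonDirac ρ U m 1).det :=
  integral_cexp_neg_quadForm (posDef_wilsonDirac_add_conjTranspose ρ hρ U hm)

/-- The same in the normalisation `D[η] = ∏ dRe(ηᵢ)dIm(ηᵢ)/π`:
**`1/det D_W(U, m) = ∫D[η] e^{−η†D_W(U,m)η}`** for `m > 0` and every gauge field.
[cite: FinkenrathKnechtliLeder2013OneFlavor, §2.1 eq. (2.1)];
[cite: MontvayMunster1994, §7.4 (text after (7.136))] -/
theorem integral_D_cexp_neg_quadForm_wilsonDirac (hρ : ∀ g, ρ g ∈ Matrix.unitaryGroup (Fin N) ℂ)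
    (U : GaugeConfig 4 L G) {m : ℝ} (hm : 0 < m) :
    ((π : ℂ) ^ Fintype.card (TorusSite 4 L × Fin N × Fin 4))⁻¹ *
        ∫ η : TorusSite 4 L × Fin N × Fin 4 → ℂ, cexp (-(star η ⬝ᵥ (wilsonDirac ρ U m 1 *ᵥ η))) =
      1 / (wilsonDirac ρ U m 1).det :=
  integral_D_cexp_neg_quadForm (posDef_wilsonDirac_add_conjTranspose ρ hρ U hm)

/-- **The Gaussian-noise estimator of `1/det D_W` is unbiased** (Finkenrath–Knechtli–Leder (2.2) at
`A = D_W(U, m)`): with `p(η) = e^{−η†η}` and `W(η) = e^{−η†(D_W − I)η}`,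
`∫ e^{−|η|²} W(η) dη = πⁿ/det D_W(U, m)`, i.e. `⟨W⟩_p = 1/det D_W`, for `m > 0` and every gauge field.
[cite: FinkenrathKnechtliLeder2013OneFlavor, §2.1 eqs. (2.1)–(2.2)];
[cite: MontvayMunster1994, §7.4 (text after (7.136))] -/
theorem integral_gaussian_mul_detInvEst_wilsonDirac
    (hρ : ∀ g, ρ g ∈ Matrix.unitaryGroup (Fin N) ℂ) (U : GaugeConfig 4 L G) {m : ℝ} (hm : 0 < m) :
    ∫ η : TorusSite 4 L × Fin N × Fin 4 → ℂ,
        (Real.exp (-(∑ i, ‖η i‖ ^ 2)) : ℂ) * cexp (-(star η ⬝ᵥ ((wilsonDirac ρ U m 1 - 1) *ᵥ η))) =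
      (π : ℂ) ^ Fintype.card (TorusSite 4 L × Fin N × Fin 4) / (wilsonDirac ρ U m 1).det :=
  integral_gaussian_mul_detInvEst' (posDef_wilsonDirac_add_conjTranspose ρ hρ U hm)

end Literature.MathematicalPhysics.QuantumLattice
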